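/- WIDTH seat `ym-line-cbag-p1-w3` (prover-ym-line-cbag-p1-w3-g16-0), LINE 7 `GlueballBandRecursion`, in support of ⟨stmt-QuantumFields-22957⟩
`OneParticleBlochSymbolFamily`: Löwdin orthonormalisation, part 2d — the ADAPTER from cluster-expansion-native bounds on a dressed covariant
family (`Gram − 1` and `⟪φ, 𝕋φ⟫`, weighted row sums against `(1 + siteSize)²`) to the hopping-kernel clauses of the registered stub
`Band.IsolatedBandFrame` (`entryNorm`, `siteSize`, on-site floor) for its Löwdin frame `ψ = φ·(√gram φ)⁻¹`.  Route-independent; def-free; helper. -/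
import Summits.QuantumFields.YangMills.Theorems.GlueballBandRecursionLowdinKernel
import Summits.QuantumFields.YangMills.Theorems.GlueballBandRecursionSymbolVolumeLimit

/-!
# Route `GlueballBandRecursion`, item `OneParticleBlochSymbolFamily` (stmt-QuantumFields-22957): kernel clauses of the Löwdin frame

The stub `Band.IsolatedBandFrame` (…IsolatedBandDefs) asks, for the normalised hopping kernel `J = transferKernel r β N ψ` of a covariant
ORTHONORMAL frame `ψ`, an on-site floor `s‖u‖² ≤ Re⟪u, J(0)u⟫`, off-site mass `Σ_{z≠0} ‖J z‖₁ ≤ θ s`, on-site mass `‖J 0‖₁ ≤ M s` and second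
moment `Σ_z |z̃|₁² ‖J z‖₁ ≤ M s` (`‖·‖₁ = entryNorm`, `|z̃|₁ = siteSize`).  A cluster expansion produces a covariant, linearly independent but
NON-orthogonal family `φ` with matrix elements `H = ⟪φ, 𝕋φ⟫` and Gram defect `gram φ − 1`, both with weighted row bounds.  This file turns
the latter into the former for the Löwdin frame `ψ_c = Σ_b ((√gram φ)⁻¹)_{bc} φ_b` (`…LowdinKernel`):

* §1 `siteSize` is subadditive, so `W = (1 + siteSize)²` is an admissible weight (`≥ 1`, `W(0) = 1`, `W(c−a) ≤ W(b−a)W(c−b)`, `siteSize² ≤ W`).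
* §2 block bookkeeping: `Σ_z W(z)·‖K_z‖₁ = Σ_i Σ_c |K_{(0,i),c}| W(c.1)` for the blocks `K_z = (K_{(0,i),(z,j)})_{ij}`; quadratic forms against
  `entryNorm` for ALL vectors (`norm_inner_map_ofReal_le_entryNorm_mul`), and the on-site floor under an `entryNorm`-small perturbation.
* §3 `lowdin_transferKernel_eq`: `λ₊·J z = (RᵀHR)`-blocks; `lowdin_kernel_clauses`: if `Σ_c |(gram φ − 1)_{ac}| W ≤ δ ≤ 1/2` and
  `Σ_c |H_{ac}| W ≤ h` for all rows `a`, then `Σ_z W(z)‖λ₊ J z − H_z‖₁ ≤ n h γ` and `Σ_z W(z)‖λ₊ J z‖₁ ≤ n h/(1−δ)²`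
  (`γ = (δ/(1−δ))(1/(1−δ) + 1)`), whence the four stub clauses with explicit constants from on-site data of `H`
  (`lowdin_kernel_floor`, `lowdin_kernel_offsite`, `lowdin_kernel_onsite`, `lowdin_kernel_moment`).

Sources: folklore.  HONEST FRAMING.  Bookkeeping for a conditional door; item 22957, LINE 7's rung `ColdDoublingRecursionStrongCoupling` and the
Yang–Mills mass gap / the summit `YangMills` are NOT proved or advanced here.
-/

set_option autoImplicit false

noncomputable section

open scoped InnerProductSpace BigOperators MatrixOrder
open Finset Matrix MeasureTheory
open Literature.MathematicalPhysics.QuantumFieldTheory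

namespace Summit.QuantumFields.YangMills.Theorems.GlueballBandRecursion.Band

/-! ### §1 The quadratic site weight `W = (1 + siteSize)²` -/

section Weight

variable {N : ℕ}

/-- `siteSize 0 = 0`. -/
theorem siteSize_zero : siteSize (0 : Site 3 N) = 0 := by
  simp [siteSize, ZMod.valMinAbs_zero]

/-- `siteSize` is subadditive (the centred representative of a sum is at most the sum of the centred representatives in size). -/
theorem siteSize_add_le (a b : Site 3 N) : siteSize (a + b) ≤ siteSize a + siteSize b := by
  unfold siteSize
  rw [← Finset.sum_add_distrib]
  refine Finset.sum_le_sum fun μ _ => ?_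
  rw [Pi.add_apply]
  exact (ZMod.natAbs_valMinAbs_add_le _ _).trans (Int.natAbs_add_le _ _)

/-- The weight `W(z) = (1 + siteSize z)²` is `≥ 1`. -/
theorem one_le_siteWeight (z : Site 3 N) : (1 : ℝ) ≤ ((1 : ℝ) + siteSize z) ^ 2 := by
  have h : (0 : ℝ) ≤ siteSize z := Nat.cast_nonneg _
  nlinarith

/-- `W(0) = 1`. -/
theorem siteWeight_zero : ((1 : ℝ) + (siteSize (0 : Site 3 N) : ℝ)) ^ 2 = 1 := by
  rw [siteSize_zero, Nat.cast_zero, add_zero, one_pow]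

/-- Submultiplicativity of `W` along differences: `W(c − a) ≤ W(b − a)·W(c − b)`. -/
theorem siteWeight_submul (a b c : Site 3 N) :
    ((1 : ℝ) + siteSize (c - a)) ^ 2 ≤ ((1 : ℝ) + siteSize (b - a)) ^ 2 * ((1 : ℝ) + siteSize (c - b)) ^ 2 := by
  rw [← mul_pow]
  have h : (siteSize (c - a) : ℝ) ≤ siteSize (b - a) + siteSize (c - b) := by
    have h1 := siteSize_add_le (b - a) (c - b)
    rw [show b - a + (c - b) = c - a by abel] at h1
    exact_mod_cast h1
  have h0 : (0 : ℝ) ≤ siteSize (b - a) := Nat.cast_nonneg _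
  have h1 : (0 : ℝ) ≤ siteSize (c - b) := Nat.cast_nonneg _
  have h2 : (0 : ℝ) ≤ siteSize (c - a) := Nat.cast_nonneg _
  exact pow_le_pow_left₀ (by positivity) (by nlinarith) 2

/-- `siteSize² ≤ W`. -/
theorem siteSize_sq_le_siteWeight (z : Site 3 N) : (siteSize z : ℝ) ^ 2 ≤ ((1 : ℝ) + siteSize z) ^ 2 :=
  pow_le_pow_left₀ (Nat.cast_nonneg _) (by linarith) 2

end Weight

/-! ### §2 Block bookkeeping and quadratic forms against `entryNorm` -/

section Blocks

variable {N : ℕ} [NeZero N] {n : ℕ}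

/-- Weighted block masses are sums of weighted rows: `Σ_z W(z)·‖K_z‖₁ = Σ_i Σ_c |K_{(0,i),c}|·W(c.1)` for `K_z = (K_{(0,i),(z,j)})_{ij}`. -/
theorem sum_weight_entryNorm_block (K : Matrix (Site 3 N × Fin n) (Site 3 N × Fin n) ℝ) (W : Site 3 N → ℝ) :
    ∑ z, W z * entryNorm (Matrix.of fun i j : Fin n => K (0, i) (z, j)) =
      ∑ i : Fin n, ∑ c : Site 3 N × Fin n, |K (0, i) c| * W c.1 := by
  simp only [entryNorm, Matrix.of_apply, Finset.mul_sum]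
  rw [Finset.sum_comm]
  refine Finset.sum_congr rfl fun i _ => ?_
  rw [Fintype.sum_prod_type]
  exact Finset.sum_congr rfl fun z _ => Finset.sum_congr rfl fun j _ => mul_comm _ _

/-- `entryNorm` is the entrywise ℓ¹ norm: `‖A − B‖₁`-perturbations, triangle inequality. -/
theorem entryNorm_le_add_entryNorm_sub (A B : Matrix (Fin n) (Fin n) ℝ) : entryNorm A ≤ entryNorm B + entryNorm (A - B) := by
  simp only [entryNorm, ← Finset.sum_add_distrib]
  refine Finset.sum_le_sum fun i _ => Finset.sum_le_sum fun j _ => ?_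
  rw [Matrix.sub_apply]
  have := abs_add_le (B i j) (A i j - B i j)
  rwa [add_sub_cancel] at this

/-- `entryNorm (c • A) = |c|·entryNorm A`. -/
theorem entryNorm_smul (c : ℝ) (A : Matrix (Fin n) (Fin n) ℝ) : entryNorm (c • A) = |c| * entryNorm A := by
  simp only [entryNorm, Matrix.smul_apply, smul_eq_mul, abs_mul, Finset.mul_sum]

/-- Quadratic forms are dominated by `entryNorm` for EVERY vector: `‖⟪u, A u⟫‖ ≤ ‖A‖₁·‖u‖²` (complexified real matrix). -/
theorem norm_inner_map_ofReal_le_entryNorm_mul (A : Matrix (Fin n) (Fin n) ℝ) (u : EuclideanSpace ℂ (Fin n)) :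
    ‖⟪u, Matrix.toEuclideanLin (A.map Complex.ofReal) u⟫_ℂ‖ ≤ entryNorm A * ‖u‖ ^ 2 := by
  have hcoord : ∀ i, ‖u i‖ ≤ ‖u‖ := fun i => PiLp.norm_apply_le u i
  rw [EuclideanSpace.inner_eq_star_dotProduct, Matrix.ofLp_toLpLin, Matrix.toLin'_apply, dotProduct]
  have hterm : ∀ j, ‖((A.map Complex.ofReal) *ᵥ WithLp.ofLp u) j * (star (WithLp.ofLp u)) j‖ ≤
      ∑ k, ‖(A.map Complex.ofReal) j k‖ * ‖u‖ ^ 2 := by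
    intro j
    rw [norm_mul, Pi.star_apply, norm_star, Matrix.mulVec, dotProduct]
    refine (mul_le_mul_of_nonneg_right (norm_sum_le _ _) (norm_nonneg _)).trans ?_
    rw [Finset.sum_mul]
    refine Finset.sum_le_sum fun k _ => ?_
    rw [norm_mul]
    calc ‖(A.map Complex.ofReal) j k‖ * ‖(WithLp.ofLp u) k‖ * ‖(WithLp.ofLp u) j‖
        ≤ ‖(A.map Complex.ofReal) j k‖ * ‖u‖ * ‖u‖ :=
          mul_le_mul (mul_le_mul_of_nonneg_left (hcoord k) (norm_nonneg _)) (hcoord j) (norm_nonneg _) (by positivity)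
      _ = ‖(A.map Complex.ofReal) j k‖ * ‖u‖ ^ 2 := by ring
  calc _ ≤ ∑ j, ∑ k, ‖(A.map Complex.ofReal) j k‖ * ‖u‖ ^ 2 := (norm_sum_le _ _).trans (Finset.sum_le_sum fun j _ => hterm j)
    _ = entryNorm A * ‖u‖ ^ 2 := by
        simp only [Matrix.map_apply, Complex.norm_real, Real.norm_eq_abs, entryNorm, Finset.sum_mul]

/-- **On-site floor under perturbation**: if `s‖u‖² ≤ Re⟪u, A u⟫` for all `u`, then `(s − ‖B − A‖₁)‖u‖² ≤ Re⟪u, B u⟫` for all `u`. -/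
theorem floor_of_entryNorm_sub (A B : Matrix (Fin n) (Fin n) ℝ) {s : ℝ}
    (hA : ∀ u : EuclideanSpace ℂ (Fin n), s * ‖u‖ ^ 2 ≤ RCLike.re ⟪u, Matrix.toEuclideanLin (A.map Complex.ofReal) u⟫_ℂ)
    (u : EuclideanSpace ℂ (Fin n)) :
    (s - entryNorm (B - A)) * ‖u‖ ^ 2 ≤ RCLike.re ⟪u, Matrix.toEuclideanLin (B.map Complex.ofReal) u⟫_ℂ := by
  have hsplit : B.map Complex.ofReal = A.map Complex.ofReal + (B - A).map Complex.ofReal := by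
    ext i j
    simp only [Matrix.map_apply, Matrix.add_apply, Matrix.sub_apply]
    push_cast
    ring
  rw [hsplit, map_add, LinearMap.add_apply, inner_add_right, map_add]
  have h1 := hA u
  have h2 : -(entryNorm (B - A) * ‖u‖ ^ 2) ≤ RCLike.re ⟪u, Matrix.toEuclideanLin ((B - A).map Complex.ofReal) u⟫_ℂ := by
    have h := norm_inner_map_ofReal_le_entryNorm_mul (B - A) u
    have h' := (RCLike.abs_re_le_norm ⟪u, Matrix.toEuclideanLin ((B - A).map Complex.ofReal) u⟫_ℂ).trans h
    exact (abs_le.1 h').1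
  linarith

end Blocks

/-! ### §3 The kernel clauses of the Löwdin frame -/

section Frame

variable {E : Type*} [NormedAddCommGroup E] [InnerProductSpace ℝ E] {ι : Type*} [Fintype ι] [DecidableEq ι]

/-- The Löwdin weight matrix `(√gram φ)⁻¹` is symmetric. -/
theorem transpose_inv_sqrt_gram (φ : ι → E) : ((CFC.sqrt (gram ℝ φ))⁻¹)ᵀ = (CFC.sqrt (gram ℝ φ))⁻¹ := by
  rw [transpose_nonsing_inv, (sqrt_gram_mul_self_and_transpose φ).2]

omit [Fintype ι] [DecidableEq ι] in
/-- The Gram matrix of a real family is symmetric. -/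
theorem transpose_gram (φ : ι → E) : (gram ℝ φ)ᵀ = gram ℝ φ := by
  have h := isHermitian_gram ℝ φ
  rwa [Matrix.IsHermitian, conjTranspose_eq_transpose_of_trivial] at h

end Frame

section Transfer

variable {G : Type} [Group G] [TopologicalSpace G] [IsTopologicalGroup G] [CompactSpace G]
  [MeasurableSpace G] [BorelSpace G]

variable (r : LatticeRep G) (β : ℝ) (N : ℕ) [NeZero N] {n : ℕ}
  (φ : Site 3 N × Fin n → Lp ℝ 2 (Measure.pi fun _ : Edge 3 N => haarProbability G))

/-- **The hopping kernel of the Löwdin frame** `ψ_c = Σ_b R_{bc} φ_b`, `R = (√gram φ)⁻¹`: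
`transferKernel r β N ψ z = λ₊⁻¹ • (R H R)_{(0,·),(z,·)}` with `H_{ac} = ⟪φ_a, 𝕋 φ_c⟫` (`λ₊ = transferSpectralRadius`). -/
theorem lowdin_transferKernel_eq (z : Site 3 N) :
    transferKernel r β N (fun c => ∑ b, (CFC.sqrt (gram ℝ φ))⁻¹ b c • φ b) z =
      (transferSpectralRadius r.ρ β N)⁻¹ •
        Matrix.of fun i j : Fin n => ((CFC.sqrt (gram ℝ φ))⁻¹ *
          Matrix.of (fun a c => ⟪φ a, wilsonTorusTransferMatrix r.ρ β N (φ c)⟫_ℝ) * (CFC.sqrt (gram ℝ φ))⁻¹) (0, i) (z, j) := by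
  ext i j
  rw [transferKernel, Matrix.of_apply, Matrix.smul_apply, Matrix.of_apply, smul_eq_mul]
  congr 1
  have h := inner_lowdin_apply_lowdin φ ((CFC.sqrt (gram ℝ φ))⁻¹) (wilsonTorusTransferMatrix r.ρ β N : _ →ₗ[ℝ] _) (0, i) (z, j)
  rw [transpose_inv_sqrt_gram] at h
  exact h

/-- **Weighted closeness of the Löwdin kernel to the dressed kernel.**  If the Gram defect and the dressed matrix elements have weighted rows
`Σ_c |(gram φ − 1)_{ac}|·W(c.1 − a.1) ≤ δ ≤ 1/2` and `Σ_c |H_{ac}|·W(c.1 − a.1) ≤ h` for all `a` (`W = (1 + siteSize)²`, `H_{ac} = ⟪φ_a, 𝕋φ_c⟫`), then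
the blocks `K_z = ((R H R)_{(0,i),(z,j)})_{ij}` (`R = (√gram φ)⁻¹`; `K_z = λ₊·transferKernel ψ z` by `lowdin_transferKernel_eq`) and
`H_z = (H_{(0,i),(z,j)})_{ij}` satisfy `Σ_z W(z)·‖K_z − H_z‖₁ ≤ n·h·(δ/(1−δ))·(1/(1−δ) + 1)` and `Σ_z W(z)·‖K_z‖₁ ≤ n·h/(1−δ)²`. -/
theorem lowdin_kernel_weighted_bounds {δ h : ℝ} (hδ : δ ≤ 1 / 2)
    (hG : ∀ a, ∑ c, |(gram ℝ φ - 1) a c| * ((1 : ℝ) + siteSize (c.1 - a.1)) ^ 2 ≤ δ)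
    (hH : ∀ a, ∑ c, |⟪φ a, wilsonTorusTransferMatrix r.ρ β N (φ c)⟫_ℝ| * ((1 : ℝ) + siteSize (c.1 - a.1)) ^ 2 ≤ h) :
    (∑ z, ((1 : ℝ) + siteSize z) ^ 2 *
        entryNorm (Matrix.of fun i j : Fin n => ((CFC.sqrt (gram ℝ φ))⁻¹ *
            Matrix.of (fun a c => ⟪φ a, wilsonTorusTransferMatrix r.ρ β N (φ c)⟫_ℝ) * (CFC.sqrt (gram ℝ φ))⁻¹ -
            Matrix.of (fun a c => ⟪φ a, wilsonTorusTransferMatrix r.ρ β N (φ c)⟫_ℝ)) (0, i) (z, j)) ≤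
        n * (h * (δ / (1 - δ)) * (1 / (1 - δ) + 1))) ∧
    (∑ z, ((1 : ℝ) + siteSize z) ^ 2 *
        entryNorm (Matrix.of fun i j : Fin n => ((CFC.sqrt (gram ℝ φ))⁻¹ *
            Matrix.of (fun a c => ⟪φ a, wilsonTorusTransferMatrix r.ρ β N (φ c)⟫_ℝ) * (CFC.sqrt (gram ℝ φ))⁻¹) (0, i) (z, j)) ≤
        n * (h / (1 - δ) ^ 2)) := by
  set Hm : Matrix (Site 3 N × Fin n) (Site 3 N × Fin n) ℝ :=
    Matrix.of (fun a c => ⟪φ a, wilsonTorusTransferMatrix r.ρ β N (φ c)⟫_ℝ) with hHm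
  set ω : Site 3 N × Fin n → Site 3 N × Fin n → ℝ := fun a c => ((1 : ℝ) + siteSize (c.1 - a.1)) ^ 2 with hω
  have hω1 : ∀ a c, 1 ≤ ω a c := fun a c => one_le_siteWeight _
  have hωd : ∀ a, ω a a = 1 := fun a => by simp only [hω, sub_self]; exact siteWeight_zero
  have hωm : ∀ a b c, ω a c ≤ ω a b * ω b c := fun a b c => siteWeight_submul a.1 b.1 c.1
  have hH' : ∀ a, ∑ c, |Hm a c| * ω a c ≤ h := fun a => by simpa only [hHm, Matrix.of_apply] using hH a
  have hrow := fun a => Lowdin.weighted_row_lowdin_kernel_le (gram ℝ φ) Hm (transpose_gram φ) ω hω1 hωd hωm hδ hG hH' a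
  have hconv : ∀ (K : Matrix (Site 3 N × Fin n) (Site 3 N × Fin n) ℝ),
      ∑ z, ((1 : ℝ) + siteSize z) ^ 2 * entryNorm (Matrix.of fun i j : Fin n => K (0, i) (z, j)) =
        ∑ i : Fin n, ∑ c : Site 3 N × Fin n, |K (0, i) c| * ω (0, i) c := fun K => by
    rw [sum_weight_entryNorm_block]
    simp only [hω, sub_zero]
  have hsum : ∀ (K : Matrix (Site 3 N × Fin n) (Site 3 N × Fin n) ℝ) (B : ℝ),
      (∀ a, ∑ c, |K a c| * ω a c ≤ B) → ∑ i : Fin n, ∑ c : Site 3 N × Fin n, |K (0, i) c| * ω (0, i) c ≤ n * B := fun K B hB => by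
    calc ∑ i : Fin n, ∑ c : Site 3 N × Fin n, |K (0, i) c| * ω (0, i) c ≤ ∑ _i : Fin n, B :=
          Finset.sum_le_sum fun i _ => hB (0, i)
      _ = n * B := by rw [Finset.sum_const, Finset.card_univ, Fintype.card_fin, nsmul_eq_mul]
  refine ⟨?_, ?_⟩
  · rw [hconv]
    exact hsum _ _ fun a => (hrow a).1
  · rw [hconv]
    exact hsum _ _ fun a => (hrow a).2

/-- `(c • A).map ofReal = c • A.map ofReal` (real scalars act on the complexification). -/
theorem map_ofReal_smul (c : ℝ) (A : Matrix (Fin n) (Fin n) ℝ) :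
    (c • A).map Complex.ofReal = (c : ℂ) • A.map Complex.ofReal := by
  ext i j
  simp only [Matrix.map_apply, Matrix.smul_apply, smul_eq_mul, Complex.ofReal_mul]

/-- Rayleigh quotients scale: `Re⟪u, (c • A) u⟫ = c·Re⟪u, A u⟫` for real `c`. -/
theorem re_inner_smul_map_ofReal (c : ℝ) (A : Matrix (Fin n) (Fin n) ℝ) (u : EuclideanSpace ℂ (Fin n)) :
    RCLike.re ⟪u, Matrix.toEuclideanLin ((c • A).map Complex.ofReal) u⟫_ℂ =
      c * RCLike.re ⟪u, Matrix.toEuclideanLin (A.map Complex.ofReal) u⟫_ℂ := by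
  rw [map_ofReal_smul, map_smul, LinearMap.smul_apply, inner_smul_right]
  simp only [RCLike.re_to_complex, Complex.re_ofReal_mul]

/-- **The four hopping-kernel clauses of `Band.IsolatedBandFrame` for the Löwdin frame, from dressed data.**  With the weighted row bounds of
`lowdin_kernel_weighted_bounds` (`δ ≤ 1/2`, `h`) and on-site data of the dressed kernel blocks `H_z` — floor `s_H‖u‖² ≤ Re⟪u, H_0 u⟫`, off-site
mass `Σ_{z≠0} ‖H_z‖₁ ≤ t_H`, on-site mass `‖H_0‖₁ ≤ m_H` — the kernel `J = transferKernel r β N ψ` of the Löwdin frame `ψ` satisfies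
(`λ₊ = transferSpectralRadius`, `γ = (δ/(1−δ))(1/(1−δ)+1)`, `β ≥ 0`):
floor `((s_H − nhγ)/λ₊)‖u‖² ≤ Re⟪u, J(0)u⟫`, off-site `Σ_{z≠0} ‖J z‖₁ ≤ (t_H + nhγ)/λ₊`, on-site `‖J 0‖₁ ≤ (m_H + nhγ)/λ₊`, moment
`Σ_z siteSize(z)² ‖J z‖₁ ≤ (nh/(1−δ)²)/λ₊`.  (So dominance `θ` and `M` of the stub follow as soon as `t_H + 2nhγ < s_H`.) -/
theorem lowdin_kernel_clauses (hβ : 0 ≤ β) {δ h sH tH mH : ℝ} (hδ : δ ≤ 1 / 2)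
    (hG : ∀ a, ∑ c, |(gram ℝ φ - 1) a c| * ((1 : ℝ) + siteSize (c.1 - a.1)) ^ 2 ≤ δ)
    (hH : ∀ a, ∑ c, |⟪φ a, wilsonTorusTransferMatrix r.ρ β N (φ c)⟫_ℝ| * ((1 : ℝ) + siteSize (c.1 - a.1)) ^ 2 ≤ h)
    (hfloor : ∀ u : EuclideanSpace ℂ (Fin n), sH * ‖u‖ ^ 2 ≤ RCLike.re ⟪u, Matrix.toEuclideanLin
      ((Matrix.of fun i j : Fin n => ⟪φ (0, i), wilsonTorusTransferMatrix r.ρ β N (φ (0, j))⟫_ℝ).map Complex.ofReal) u⟫_ℂ)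
    (hoff : ∑ z ∈ Finset.univ.erase 0,
      entryNorm (Matrix.of fun i j : Fin n => ⟪φ (0, i), wilsonTorusTransferMatrix r.ρ β N (φ (z, j))⟫_ℝ) ≤ tH)
    (hon : entryNorm (Matrix.of fun i j : Fin n => ⟪φ (0, i), wilsonTorusTransferMatrix r.ρ β N (φ (0, j))⟫_ℝ) ≤ mH) :
    let J := transferKernel r β N (fun c => ∑ b, (CFC.sqrt (gram ℝ φ))⁻¹ b c • φ b)
    let Λ := transferSpectralRadius r.ρ β N
    let γ := h * (δ / (1 - δ)) * (1 / (1 - δ) + 1)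
    (∀ u : EuclideanSpace ℂ (Fin n),
        (sH - n * γ) / Λ * ‖u‖ ^ 2 ≤ RCLike.re ⟪u, Matrix.toEuclideanLin ((J 0).map Complex.ofReal) u⟫_ℂ) ∧
      (∑ z ∈ Finset.univ.erase 0, entryNorm (J z) ≤ (tH + n * γ) / Λ) ∧
      (entryNorm (J 0) ≤ (mH + n * γ) / Λ) ∧
      (∑ z, (siteSize z : ℝ) ^ 2 * entryNorm (J z) ≤ n * (h / (1 - δ) ^ 2) / Λ) := by
  classical
  intro J Λ γ
  haveI : SecondCountableTopology G :=
    (r.continuous.isClosedEmbedding r.injective).isEmbedding.secondCountableTopology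
  have hΛ : 0 < Λ := by
    obtain ⟨s, _, b, lam, i₀, -, -, hL0, hrad, -⟩ := exists_eigenData_rate r hβ N
    change 0 < transferSpectralRadius r.ρ β N
    rw [hrad]; exact hL0
  obtain ⟨h1, h2⟩ := lowdin_kernel_weighted_bounds r β N φ hδ hG hH
  -- names for the blocks
  set R : Matrix (Site 3 N × Fin n) (Site 3 N × Fin n) ℝ := (CFC.sqrt (gram ℝ φ))⁻¹ with hRdef
  set Hm : Matrix (Site 3 N × Fin n) (Site 3 N × Fin n) ℝ :=
    Matrix.of (fun a c => ⟪φ a, wilsonTorusTransferMatrix r.ρ β N (φ c)⟫_ℝ) with hHm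
  set Kb : Site 3 N → Matrix (Fin n) (Fin n) ℝ := fun z => Matrix.of fun i j : Fin n => (R * Hm * R) (0, i) (z, j) with hKb
  set Hb : Site 3 N → Matrix (Fin n) (Fin n) ℝ := fun z => Matrix.of fun i j : Fin n => Hm (0, i) (z, j) with hHb
  have hJ : ∀ z, J z = Λ⁻¹ • Kb z := fun z => lowdin_transferKernel_eq r β N φ z
  have hblock : ∀ z, (Matrix.of fun i j : Fin n => (R * Hm * R - Hm) (0, i) (z, j)) = Kb z - Hb z := fun z => by
    ext i j; simp only [hKb, hHb, Matrix.of_apply, Matrix.sub_apply]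
  have hHb0 : Hb 0 = Matrix.of fun i j : Fin n => ⟪φ (0, i), wilsonTorusTransferMatrix r.ρ β N (φ (0, j))⟫_ℝ := by
    ext i j; simp only [hHb, hHm, Matrix.of_apply]
  have hHbz : ∀ z, Hb z = Matrix.of fun i j : Fin n => ⟪φ (0, i), wilsonTorusTransferMatrix r.ρ β N (φ (z, j))⟫_ℝ := fun z => by
    ext i j; simp only [hHb, hHm, Matrix.of_apply]
  simp only [hblock] at h1
  -- entrywise consequences of the weighted bounds
  have hW1 : ∀ z : Site 3 N, (1 : ℝ) ≤ ((1 : ℝ) + siteSize z) ^ 2 := fun z => one_le_siteWeight z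
  have hE0 : ∀ z, 0 ≤ entryNorm (Kb z - Hb z) := fun z =>
    Finset.sum_nonneg fun i _ => Finset.sum_nonneg fun j _ => abs_nonneg _
  have hE0' : ∀ z, 0 ≤ entryNorm (Kb z) := fun z => Finset.sum_nonneg fun i _ => Finset.sum_nonneg fun j _ => abs_nonneg _
  have hdiff_all : ∑ z, entryNorm (Kb z - Hb z) ≤ n * γ := by
    refine le_trans (Finset.sum_le_sum fun z _ => ?_) h1
    exact le_mul_of_one_le_left (hE0 z) (hW1 z)
  have hdiff0 : entryNorm (Kb 0 - Hb 0) ≤ n * γ :=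
    (Finset.single_le_sum (fun z _ => hE0 z) (Finset.mem_univ (0 : Site 3 N))).trans hdiff_all
  have hdiff_off : ∑ z ∈ Finset.univ.erase 0, entryNorm (Kb z - Hb z) ≤ n * γ :=
    (Finset.sum_le_sum_of_subset_of_nonneg (Finset.erase_subset _ _) fun z _ _ => hE0 z).trans hdiff_all
  -- scaling by `Λ⁻¹`
  have hJnorm : ∀ z, entryNorm (J z) = Λ⁻¹ * entryNorm (Kb z) := fun z => by
    rw [hJ z, entryNorm_smul, abs_of_pos (inv_pos.2 hΛ)]
  refine ⟨fun u => ?_, ?_, ?_, ?_⟩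
  · -- floor
    rw [hJ 0, re_inner_smul_map_ofReal]
    have hf := floor_of_entryNorm_sub (Hb 0) (Kb 0) (by rw [hHb0]; exact hfloor) u
    have hu : 0 ≤ ‖u‖ ^ 2 := sq_nonneg _
    calc (sH - n * γ) / Λ * ‖u‖ ^ 2 = Λ⁻¹ * ((sH - n * γ) * ‖u‖ ^ 2) := by rw [div_eq_inv_mul, mul_assoc]
      _ ≤ Λ⁻¹ * ((sH - entryNorm (Kb 0 - Hb 0)) * ‖u‖ ^ 2) :=
          mul_le_mul_of_nonneg_left (mul_le_mul_of_nonneg_right (by linarith [hdiff0]) hu) (inv_nonneg.2 hΛ.le)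
      _ ≤ Λ⁻¹ * RCLike.re ⟪u, Matrix.toEuclideanLin ((Kb 0).map Complex.ofReal) u⟫_ℂ :=
          mul_le_mul_of_nonneg_left hf (inv_nonneg.2 hΛ.le)
  · -- off-site mass
    have hsplit : ∑ z ∈ Finset.univ.erase 0, entryNorm (Kb z) ≤ tH + n * γ := by
      calc ∑ z ∈ Finset.univ.erase 0, entryNorm (Kb z)
          ≤ ∑ z ∈ Finset.univ.erase 0, (entryNorm (Hb z) + entryNorm (Kb z - Hb z)) :=
            Finset.sum_le_sum fun z _ => entryNorm_le_add_entryNorm_sub _ _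
        _ ≤ tH + n * γ := by
            rw [Finset.sum_add_distrib]
            refine add_le_add ?_ hdiff_off
            simpa only [hHbz] using hoff
    simp_rw [hJnorm, ← Finset.mul_sum]
    rw [div_eq_inv_mul]
    exact mul_le_mul_of_nonneg_left hsplit (inv_nonneg.2 hΛ.le)
  · -- on-site mass
    rw [hJnorm, div_eq_inv_mul]
    refine mul_le_mul_of_nonneg_left ?_ (inv_nonneg.2 hΛ.le)
    calc entryNorm (Kb 0) ≤ entryNorm (Hb 0) + entryNorm (Kb 0 - Hb 0) := entryNorm_le_add_entryNorm_sub _ _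
      _ ≤ mH + n * γ := add_le_add (by rw [hHb0]; exact hon) hdiff0
  · -- second moment
    simp_rw [hJnorm]
    calc ∑ z, (siteSize z : ℝ) ^ 2 * (Λ⁻¹ * entryNorm (Kb z)) = Λ⁻¹ * ∑ z, (siteSize z : ℝ) ^ 2 * entryNorm (Kb z) := by
          rw [Finset.mul_sum]; exact Finset.sum_congr rfl fun z _ => by ring
      _ ≤ Λ⁻¹ * ∑ z, ((1 : ℝ) + siteSize z) ^ 2 * entryNorm (Kb z) :=
          mul_le_mul_of_nonneg_left (Finset.sum_le_sum fun z _ =>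
            mul_le_mul_of_nonneg_right (siteSize_sq_le_siteWeight z) (hE0' z)) (inv_nonneg.2 hΛ.le)
      _ ≤ Λ⁻¹ * (n * (h / (1 - δ) ^ 2)) := mul_le_mul_of_nonneg_left h2 (inv_nonneg.2 hΛ.le)
      _ = n * (h / (1 - δ) ^ 2) / Λ := by ring

end Transfer

end Summit.QuantumFields.YangMills.Theorems.GlueballBandRecursion.Band

end
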